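import Literature.NumberTheory.Automorphic.RestrictedTensorProductFunctions
import Literature.NumberTheory.Automorphic.RestrictedTensorProductLift
import Literature.NumberTheory.Automorphic.FiniteAdeleFactorizable
import HarnessLib

/-!
# `𝒮((𝔸_{K,f})^ι)` is the restricted tensor product `⊗'_v 𝒮(K_v^ι)`

For a number field `K` and a finite index type `ι` the finite-adelic Schwartz–Bruhat space
`𝒮((𝔸_{K,f})^ι) = SchwartzBruhat (ι → FiniteAdeleRing (𝓞 K) K)` together with the pure-tensor map
`piProdSB K ι : (Φ_v)_v ↦ ∏_v Φ_v` from restricted families of local Schwartz–Bruhat functions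
(`Φ_v = 1_{𝒪_v^ι}` for almost all `v`, file `FiniteAdeleFactorizable`) IS a restricted tensor product
`⊗'_v (𝒮(K_v^ι), 1_{𝒪_v^ι})` in the sense of the tree's characterising predicate
`IsRestrictedTensorProduct` (Flath 1979 §2, Bump 1997 §3.4–3.5: "`S(Aⁿ) = ⊗'_v S(F_vⁿ)`"), with EMPTY
exceptional set:

* `isRestrictedTensorProduct_piProdSB : IsRestrictedTensorProduct ℂ (piProdSB K ι) ∅`.

Consequently (tree `RestrictedTensorProductLift`) every restricted-multilinear family of data on the
local spaces — e.g. restricted families of local linear operators `A_v` with `A_v 1_{𝒪_v^ι} = 1_{𝒪_v^ι}`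
for almost all `v`, or local representations `ω_v` of groups `G_v` whose distinguished compact open
subgroups fix `1_{𝒪_v^ι}` for almost all `v` — acts on `𝒮((𝔸_{K,f})^ι)` through
`IsRestrictedTensorProduct.lift / .map / .rep`, uniquely determined by its values on pure tensors
(`IsRestrictedTensorProduct.eq_lift`).  This is the function-space half of the construction of global
(finite-adelic) Weil representations as restricted tensor products of local ones.

PROOF.  The abstract instance `isRestrictedTensorProduct_prodFunW` of `RestrictedTensorProductFunctions`
(product functions on a restricted product `Πʳ_v [X_v, O_v]` span a restricted tensor product of the
local function spaces, provided `φ₀_v = 1` on `O_v ≠ ∅` off the exceptional set) is applied with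
`X_v = K_v^ι`, `O_v = 𝒪_v^ι`, `S_v = 𝒮(K_v^ι)`, `φ₀_v = 1_{𝒪_v^ι}`, and transported along the linear
isomorphism of function spaces induced by the coordinate transposition
`piTranspose K ι : (𝔸_{K,f})^ι ≃ Πʳ_v [K_v^ι, 𝒪_v^ι]` (under which `prodFun ↦ piProd` definitionally) and
the identification of the span of the product functions with `𝒮((𝔸_{K,f})^ι)`
(`span_range_piProd_eq` of `FiniteAdeleFactorizable`: every Schwartz–Bruhat function is a finite sum
of pure tensors).  The transport lemma `IsRestrictedTensorProduct.comp_linearEquiv` is proved here in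
general.

Everything in this file is proved (kernel); no cited fact is used.

## References

* [Flath1979] D. Flath, Decomposition of representations into tensor products, Corvallis I, §2–3.
* [Bump1997] D. Bump, Automorphic forms and representations, §3.4–3.5.
* [TateThesis1967] J. Tate, Fourier analysis in number fields and Hecke's zeta-functions, §3–4.
-/

open scoped RestrictedProduct TensorProduct
open Filter Function Set IsDedekindDomain NumberField PiTensorProduct

namespace Literature.NumberTheory.Automorphic

noncomputable section

/-! ### Transport of restricted tensor product structures along linear maps / isomorphisms -/

section Transport

universe u uk v w w'

variable {ι : Type u} {k : Type uk} [CommRing k] {V : ι → Type v} [∀ i, AddCommGroup (V i)]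
  [∀ i, Module k (V i)] {x₀ : ∀ i, V i} {W : Type w} [AddCommGroup W] [Module k W]
  {W' : Type w'} [AddCommGroup W'] [Module k W'] [DecidableEq ι]

/-- A restricted-multilinear map followed by a linear map is restricted-multilinear. [folklore] -/
theorem IsRestrictedMultilinear.comp_linearMap {j : RestrictedFamily V x₀ → W}
    (hj : IsRestrictedMultilinear k j) (f : W →ₗ[k] W') : IsRestrictedMultilinear k (f ∘ j) :=
  ⟨fun x i v w => by simp [hj.map_update_add], fun x i c v => by simp [hj.map_update_smul]⟩

/-- `liftFinset` of the composite is the composite of `liftFinset`. [folklore] -/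
theorem IsRestrictedMultilinear.liftFinset_comp_linearMap {j : RestrictedFamily V x₀ → W}
    (hj : IsRestrictedMultilinear k j) (f : W →ₗ[k] W') (S : Finset ι) :
    (hj.comp_linearMap f).liftFinset S = f ∘ₗ hj.liftFinset S := by
  ext m
  simp [IsRestrictedMultilinear.liftFinset_tprod]

/-- **Transport of structure.** If `(W, j)` is a restricted tensor product `⊗'_i (V i, x₀ i)` with
exceptional set `S₀` and `e : W ≃ₗ W'` is a linear isomorphism, then `(W', e ∘ j)` is a restricted tensor
product with the same exceptional set. [folklore] -/
theorem IsRestrictedTensorProduct.comp_linearEquiv {j : RestrictedFamily V x₀ → W} {S₀ : Finset ι}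
    (h : IsRestrictedTensorProduct k j S₀) (e : W ≃ₗ[k] W') :
    IsRestrictedTensorProduct k (e ∘ j) S₀ := by
  obtain ⟨hj, hinj, hsup⟩ := h
  refine ⟨hj.comp_linearMap e.toLinearMap, fun S hS => ?_, ?_⟩
  · rw [hj.liftFinset_comp_linearMap]
    exact e.injective.comp (hinj S hS)
  · simp_rw [hj.liftFinset_comp_linearMap, LinearMap.range_comp]
    rw [← Submodule.map_iSup, hsup, Submodule.map_top, LinearEquiv.range]

end Transport

/-! ### The finite-adelic Schwartz–Bruhat space as a restricted tensor product -/

section FiniteAdele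

variable (K : Type) [Field K] [NumberField K] (ι : Type) [Fintype ι]

/-- The linear isomorphism of function spaces `((Πʳ_v [K_v^ι, 𝒪_v^ι]) → ℂ) ≃ₗ ((𝔸_{K,f})^ι → ℂ)`
induced by the coordinate transposition `piTranspose`. [folklore] -/
def transposeFun :
    ((Πʳ v : HeightOneSpectrum (𝓞 K), [ι → v.adicCompletion K, integralBox K ι v]) → ℂ) ≃ₗ[ℂ]
      ((ι → FiniteAdeleRing (𝓞 K) K) → ℂ) :=
  LinearEquiv.funCongrLeft ℂ ℂ (piTranspose K ι)

/-- `transposeFun f x = f (piTranspose x)`. [folklore] -/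
@[simp] theorem transposeFun_apply
    (f : (Πʳ v : HeightOneSpectrum (𝓞 K), [ι → v.adicCompletion K, integralBox K ι v]) → ℂ)
    (x : ι → FiniteAdeleRing (𝓞 K) K) : transposeFun K ι f x = f (piTranspose K ι x) := rfl

/-- Under the transposition the abstract product function `prodFun` of a restricted family of local
Schwartz–Bruhat functions becomes the pure tensor `piProd`. [folklore] -/
theorem transposeFun_prodFun (Φ : LocalSBFamily K ι) :
    transposeFun K ι (prodFun (integralBox K ι)
      (fun v : HeightOneSpectrum (𝓞 K) => SchwartzBruhat (ι → v.adicCompletion K))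
      (fun v => unitVec K ι v) Φ) = piProd K ι Φ := rfl

/-- The transposition carries the span of the abstract product functions onto the finite-adelic
Schwartz–Bruhat space. [folklore] -/
theorem map_transposeFun_prodFunSpan :
    (prodFunSpan (integralBox K ι)
      (fun v : HeightOneSpectrum (𝓞 K) => SchwartzBruhat (ι → v.adicCompletion K))
      (fun v => unitVec K ι v)).map (transposeFun K ι).toLinearMap =
      SchwartzBruhat (ι → FiniteAdeleRing (𝓞 K) K) := by
  rw [prodFunSpan, Submodule.map_span, ← span_range_piProd_eq K ι]
  congr 1
  ext F
  constructor
  · rintro ⟨_, ⟨Φ, rfl⟩, rfl⟩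
    exact ⟨Φ, (transposeFun_prodFun K ι Φ).symm⟩
  · rintro ⟨Φ, rfl⟩
    exact ⟨_, ⟨Φ, rfl⟩, transposeFun_prodFun K ι Φ⟩

/-- The linear isomorphism `prodFunSpan ≃ₗ 𝒮((𝔸_{K,f})^ι)` from the abstract span of product functions
on `Πʳ_v [K_v^ι, 𝒪_v^ι]` to the finite-adelic Schwartz–Bruhat space, induced by the transposition.
[folklore] -/
def prodFunSpanEquiv :
    ↥(prodFunSpan (integralBox K ι)
      (fun v : HeightOneSpectrum (𝓞 K) => SchwartzBruhat (ι → v.adicCompletion K))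
      (fun v => unitVec K ι v)) ≃ₗ[ℂ] ↥(SchwartzBruhat (ι → FiniteAdeleRing (𝓞 K) K)) :=
  ((transposeFun K ι).submoduleMap _).trans (LinearEquiv.ofEq _ _ (map_transposeFun_prodFunSpan K ι))

/-- The isomorphism on underlying functions is transposition. [folklore] -/
@[simp] theorem coe_prodFunSpanEquiv
    (F : ↥(prodFunSpan (integralBox K ι)
      (fun v : HeightOneSpectrum (𝓞 K) => SchwartzBruhat (ι → v.adicCompletion K))
      (fun v => unitVec K ι v))) :
    ((prodFunSpanEquiv K ι F : ↥(SchwartzBruhat (ι → FiniteAdeleRing (𝓞 K) K))) :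
      (ι → FiniteAdeleRing (𝓞 K) K) → ℂ) = transposeFun K ι F := rfl

/-- The isomorphism carries the abstract structure map `prodFunW` to the pure-tensor map `piProdSB`.
[folklore] -/
theorem prodFunSpanEquiv_comp_prodFunW :
    (prodFunSpanEquiv K ι) ∘ prodFunW (integralBox K ι)
      (fun v : HeightOneSpectrum (𝓞 K) => SchwartzBruhat (ι → v.adicCompletion K))
      (fun v => unitVec K ι v) = piProdSB K ι := by
  funext Φ
  apply Subtype.ext
  rfl

/-- **`𝒮((𝔸_{K,f})^ι) = ⊗'_v 𝒮(K_v^ι)`.** The finite-adelic Schwartz–Bruhat space with the pure-tensor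
map `piProdSB K ι : (Φ_v)_v ↦ ∏_v Φ_v` (base vectors `1_{𝒪_v^ι}`) is a restricted tensor product of
the local Schwartz–Bruhat spaces with EMPTY exceptional set: `piProdSB` is restricted-multilinear, the
induced maps `⨂_{v ∈ T} 𝒮(K_v^ι) → 𝒮((𝔸_{K,f})^ι)` are injective for every finite `T`, and their
ranges exhaust `𝒮((𝔸_{K,f})^ι)`. (Bump 1997, §3.5, `S(Aⁿ) = ⊗'_v S(F_vⁿ)`, finite places; Flath 1979,
§2–3.) [cite: Bump1997, §3.5] -/
theorem isRestrictedTensorProduct_piProdSB [DecidableEq (HeightOneSpectrum (𝓞 K))] :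
    IsRestrictedTensorProduct ℂ (piProdSB K ι) ∅ := by
  rw [← prodFunSpanEquiv_comp_prodFunW K ι]
  exact (isRestrictedTensorProduct_prodFunW (fun v => ⟨0, zero_mem_integralBox K ι v⟩) ∅
    (fun v _ y hy => unitVec_apply_of_mem hy)).comp_linearEquiv (prodFunSpanEquiv K ι)

/-- The pure-tensor map `piProdSB` is restricted-multilinear. [folklore] -/
theorem isRestrictedMultilinear_piProdSB [DecidableEq (HeightOneSpectrum (𝓞 K))] :
    IsRestrictedMultilinear ℂ (piProdSB K ι) :=
  (isRestrictedTensorProduct_piProdSB K ι).isRestrictedMultilinear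

end FiniteAdele

end

end Literature.NumberTheory.Automorphic
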